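import Literature.Computability.AlgebraicComplexity.ValiantBooleanBridge
import Literature.Computability.Complexity.NSubexp
import Literature.Computability.Complexity.Williams2014
import Literature.Computability.Complexity.ExpTimeCollapses
import Literature.Computability.Complexity.Counting
import Literature.Computability.Complexity.OracleCompositionMachine
import Literature.Computability.Complexity.CookReducibilityTransitive
import Literature.Computability.QuantumComplexity.PermanentHardness
import Literature.Computability.QuantumComplexity.IQPPostselection
import HarnessLib

/-!
# Kabanets–Impagliazzo (pnp.S39): decomposition into named facts and conditional assembly

Companion ("Proofs") file of `Literature.Computability.AlgebraicComplexity.ValiantBooleanBridge`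
for the named fact **pnp.S39** `Literature.Computability.AlgebraicComplexity.kabanets_impagliazzo` (Kabanets–Impagliazzo, STOC 2003,
Def. 1 + Thm. 18, p. 359; Comput. Complexity 13 (2004), Thm. 1.1):
`PIT ∈ ⋂_{ε>0} NTIME(2^{n^ε}) ⟹ NEXP ⊄ P/poly ∨ (PER_n) has no p-bounded constant-free circuits`.
(The docstring of `kabanets_impagliazzo` says "STOC 2003 Thm. 21"; in the STOC numbering the
ACIT statement is Def. 1 + Thm. 18, and Cor. 21 is its `coRP`-version.)

The printed proof (STOC 2003, pp. 357–359; Arora–Barak 2009, Thm. 20.17, pp. 415–418) is a chain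
of independent theorems, each a substantial formalisation over Turing machines that the tree does
not have. Following D-0014 we vendor the chain as named facts and **prove the assembly**: the
theorem `kabanets_impagliazzo_of_facts` derives `kabanets_impagliazzo` from exactly

| step (KI 2003 / AB 2009) | tree fact | file |
|---|---|---|
| Thm. 4 [IKW02] + "`NEXP = EXP`" (AB Lemma 20.20) | `NEXP_eq_EXP_of_subset_PPoly` | `ExpTimeCollapses` |
| `EXP ⊆ P/poly ⟹ EXP = Σ₂ᵖ` (Meyer; AB Thm. 6.20), replacing "`MA ⊆ PH`" | `EXP_eq_SigmaP_two_of_subset_PPoly` | `ExpTimeCollapses` |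
| Thm. 2 (Toda), `PH ⊆ P^{PP}` | `toda_PH_subset_PRelClass_PP` | `IQPPostselection` |
| `PP ⊆ P^{#P}` | `PP_subset_PSharpP` | `Counting` |
| Thm. 1 (Valiant), `Perm` is `#P`-hard | `permanent01_isSharpPHardFun` | `PermanentHardness` |
| Cor. 12: `ACIT ∈ NSUBEXP ∧ Perm ∈ ArithSIZE(poly) ⟹ Perm ∈ NSUBEXP` | `permanent01Graph_mem_NSUBEXP_of_PIT` | here |
| Lemma 3: `Perm ∈ NTIME(t) ⟹ P^{Perm} ⊆ NTIME(poly · t ∘ poly)` (instance `NSUBEXP`) | `PRel_per01_subset_NSUBEXP_of_graph` | here |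
| nondeterministic time hierarchy (AB Thm. 3.2, separation form; instance `2ⁿ` vs `2^{n²}` derived here from `NSubexp`) | `ntime_hierarchy` | `Williams2014` |

Everything else is proved: the instance `NTIME(2^{n²}) ⊄ NTIME(2ⁿ)` of the hierarchy theorem and
`NEXP ⊄ NSUBEXP` (from `ntime_hierarchy` with the proved time-constructibility of `2ⁿ`, `2^{n²}`
and `2^{n+1} = o(2^{n²})` of `NSubexp.lean`), `P^{PP} ⊆ P^{per}`
(`PRelClass_PP_subset_PRel_per01`, from the tree's `PSharpP_subset_PRel_per01Fn` — Valiant's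
theorem composed with `OracleAlg.PRel_subset_PRel_of_mem_FPRel` — and the proved
`mem_PRel_of_polyTimeTuringReducible_holds`), `NEXP ⊆ P/poly ⟹ NEXP ⊆ P^{per}` (KI Cor. 5 /
AB (20.17), `NEXP_subset_PRel_per01_of_subset_PPoly`, through `NEXP_subset_PH_of_subset_PPoly`
of `ExpTimeCollapses.lean`), the combination of Cor. 12 with Lemma 3
(`PRel_per01_subset_NSUBEXP_of_PIT`), and the final contradiction. When the eight facts are
discharged, `kabanets_impagliazzo_holds` is `kabanets_impagliazzo_of_facts` applied to their
`_holds` theorems.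

## The two Kabanets–Impagliazzo lemmas vendored here

* `permanent01Graph` — the language `{(M, v) | M is a 0-1 matrix and v = Perm(M)}` (KI 2003,
  p. 357: "We say that Perm is computable in NTIME(t) if [this] language is in NTIME(t)"), coded
  with the tree's `encodingIntMatrix` (`ExactBosonSamplingHardness.lean`, the coding behind the
  `#P`-hardness fact `per01Fn`), binary values `encodeNat`, pairs `boolPair`.
* `permanent01Graph_mem_NSUBEXP_of_PIT` — **KI Cor. 12** (p. 358), in the special case the target
  statement needs: the tree's hypothesis "`(PER_n)` has p-bounded *constant-free* complexity"
  (`constantFreeComplexity`, constants and coefficients in `{0, ±1}`) is a sub-case of KI's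
  "Perm over `ℤ` is computable by polynomial-size arithmetic circuits (over `ℤ`, without
  divisions)" (KI §2.2: size counts gates *and* the bit sizes of constants), and the tree's
  `PITLanguage` is KI's ACIT for division-free integer circuits; KI's proof of Cor. 12 (via
  Lemma 11, identities (1)–(2)) only ever tests division-free identities.
* `PRel_per01_subset_NSUBEXP_of_graph` — **KI Lemma 3** (p. 357: "If Perm ∈ NTIME(t), then
  `P^{Perm} ⊆ NTIME(poly(n) t(poly(n)))`") in the instance used in the proof of Thm. 18
  (p. 359: "by Theorem 16, Perm ∈ NTIME(2^{n^ε}) for every ε > 0. Hence, we obtain by Lemma 3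
  that coNEXP ⊆ NTIME(2^{n^ε})"): `Perm ∈ NSUBEXP ⟹ P^{Perm} ⊆ NSUBEXP`, with `P^{Perm}` the
  tree's `PRel (Oracle.ofFun per01Fn)` (transcript model of `Oracle.lean`, adequate for this
  polynomially bounded oracle) and `NSUBEXP = ⋂_{r>0} NTIME(2^{⌊n^{1/r}⌋})`
  (`NSubexp.lean`), literally the hypothesis form of pnp.S39.

## Why the `EXP`/`Σ₂ᵖ` route instead of `MA`

KI (Thm. 4, Cor. 5) and AB (Lemma 20.18) pass through `NEXP = MA ⊆ PH`; the tree has no class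
`MA` (`Nondeterministic.lean`, design notes). Arora–Barak's own Lemma 20.20 gives `NEXP = EXP`,
and Meyer's theorem `EXP ⊆ P/poly ⟹ EXP = Σ₂ᵖ` (their Thm. 6.20, used inside Lemma 20.18) then
puts `NEXP` in `PH` without mentioning `MA`; the rest of the chain is unchanged.

## References

* V. Kabanets, R. Impagliazzo, *Derandomizing polynomial identity tests means proving circuit
  lower bounds*, STOC 2003, 355–364: Thms. 1, 2, Lemma 3, Thm. 4, Cor. 5 (p. 357), Lemma 11,
  Cor. 12 (p. 358), Def. 1, Thms. 16, 18 (p. 359); journal version Comput. Complexity 13 (2004)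
  1–46, Thm. 1.1.
* S. Arora, B. Barak, *Computational Complexity: A Modern Approach*, CUP 2009, Thm. 20.17 and
  Lemmas 20.18–20.20 (pp. 415–418), Thm. 3.2, Thm. 6.20, Thms. 17.11, 17.14.
-/

noncomputable section

namespace Literature.Computability.AlgebraicComplexity

open Filter Asymptotics

/-! ### The instance `f = 2ⁿ`, `g = 2^{n²}` of the nondeterministic time hierarchy theorem -/

/-- **`NTIME(2^{n²}) ⊄ NTIME(2ⁿ)`**: the instance `f = 2ⁿ`, `g = 2^{n²}` of the nondeterministic
time hierarchy theorem `ntime_hierarchy` (`Williams2014.lean`; Arora–Barak 2009, Thm. 3.2,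
separation form), whose side conditions are proved in `NSubexp.lean`
(`TimeConstructible.isTimeConstructible_two_pow(_sq)`, `isLittleO_two_pow_succ_two_pow_sq`).
[cite: AroraBarakCC2009, Thm. 3.2 (p. 69)] -/
theorem NTIME_two_pow_sq_not_subset_of (h : Complexity.ntime_hierarchy) :
    ¬ Complexity.NTIME (fun n => 2 ^ (n ^ 2)) ⊆ Complexity.NTIME (fun n => 2 ^ n) :=
  h _ _ Complexity.TimeConstructible.isTimeConstructible_two_pow
    Complexity.TimeConstructible.isTimeConstructible_two_pow_sq Complexity.isLittleO_two_pow_succ_two_pow_sq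

/-- **`NEXP ⊄ NTIME(2ⁿ)`** (from the hierarchy fact): otherwise `NTIME(2^{n²}) ⊆ NEXP ⊆ NTIME(2ⁿ)`,
against `NTIME_two_pow_sq_not_subset_of`. This is the form in which the hierarchy theorem closes
the Kabanets–Impagliazzo argument (Arora–Barak 2009, proof of Thm. 20.17, p. 418: "`NEXP ⊆ NP`,
contradicting the Nondeterministic Time Hierarchy Theorem").
[cite: AroraBarakCC2009, Thm. 3.2 (p. 69) and proof of Thm. 20.17 (p. 418)] -/
theorem NEXP_not_subset_NTIME_two_pow_of (h : Complexity.ntime_hierarchy) :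
    ¬ Complexity.NEXP ⊆ Complexity.NTIME (fun n => 2 ^ n) := fun hsub =>
  NTIME_two_pow_sq_not_subset_of h (Complexity.NTIME_two_pow_sq_subset_NEXP.trans hsub)

/-- **`NEXP ⊄ NSUBEXP`** (from the hierarchy fact), via `NSUBEXP ⊆ NTIME(2ⁿ)`.
Kabanets–Impagliazzo 2003, proof of Thm. 18 (p. 359): "`coNEXP ⊆ NTIME(2^{n^ε})` ... is
impossible"; here for `NEXP`, which is what the `EXP`-route of Arora–Barak Thm. 20.17 needs.
[cite: AroraBarakCC2009, Thm. 3.2 (p. 69)] [cite: KabanetsImpagliazzo2003, proof of Thm. 18 (p. 359)] -/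
theorem NEXP_not_subset_NSUBEXP_of (h : Complexity.ntime_hierarchy) : ¬ Complexity.NEXP ⊆ Complexity.NSUBEXP := fun hsub =>
  NEXP_not_subset_NTIME_two_pow_of h (hsub.trans Complexity.NSUBEXP_subset_NTIME_two_pow)

end Literature.Computability.AlgebraicComplexity

namespace Literature.Computability.AlgebraicComplexity

open _root_.Computability Complexity QuantumComplexity

/-! ### The graph of the `0/1` permanent -/

/-- The language `{(M, v) | M is a 0-1 matrix and v = Perm(M)}` of Kabanets–Impagliazzo 2003,
p. 357 ("We say that Perm is computable in NTIME(t) if the following language is in NTIME(t)"):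
code words `boolPair ⟨M⟩ (bin v)` with `M` a square `0/1` integer matrix coded by
`encodingIntMatrix`, and `v = per M ∈ ℕ`. [cite: KabanetsImpagliazzo2003, §2.1 (p. 357)] -/
def permanent01Graph : Language Bool :=
  {w | ∃ (n : ℕ) (M : Fin n → Fin n → ℤ), (∀ i j, M i j = 0 ∨ M i j = 1) ∧
    w = boolPair (encodingIntMatrix.encode ⟨n, M⟩) (encodeNat ((Matrix.of M).permanent).toNat)}

/-- Membership of a coded pair `(⟨M⟩, bin v)` with `M` a `0/1` matrix: `v = per M` (injectivity
of `boolPair`, `encodingIntMatrix`, `encodeNat`). [cite: KabanetsImpagliazzo2003, §2.1 (p. 357)] -/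
theorem boolPair_mem_permanent01Graph_iff {n : ℕ} (M : Fin n → Fin n → ℤ)
    (hM : ∀ i j, M i j = 0 ∨ M i j = 1) (v : ℕ) :
    boolPair (encodingIntMatrix.encode ⟨n, M⟩) (encodeNat v) ∈ permanent01Graph ↔
      v = ((Matrix.of M).permanent).toNat := by
  constructor
  · rintro ⟨n', M', -, h⟩
    have h1 := congr_arg (fun w => encodingIntMatrix.decode (boolUnpair w).1) h
    have h2 := congr_arg (fun w => decodeNat (boolUnpair w).2) h
    simp only [boolUnpair_boolPair, encodingIntMatrix.decode_encode, decode_encodeNat,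
      Option.some.injEq] at h1 h2
    cases h1
    exact h2
  · rintro rfl
    exact ⟨n, M, hM, rfl⟩

/-- On coded pairs, `permanent01Graph` is the graph of the tree's `0/1` permanent function
`per01Fn` (`PermanentHardness.lean`). [cite: KabanetsImpagliazzo2003, §2.1 (p. 357)] -/
theorem boolPair_mem_permanent01Graph_iff_per01Fn {n : ℕ} (M : Fin n → Fin n → ℤ)
    (hM : ∀ i j, M i j = 0 ∨ M i j = 1) (v : ℕ) :
    boolPair (encodingIntMatrix.encode ⟨n, M⟩) (encodeNat v) ∈ permanent01Graph ↔
      v = per01Fn (encodingIntMatrix.encode ⟨n, M⟩) := by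
  rw [boolPair_mem_permanent01Graph_iff M hM, per01Fn_encode M hM]

/-! ### The two Kabanets–Impagliazzo lemmas (named facts) -/

/-- **Kabanets–Impagliazzo 2003, Cor. 12** (p. 358): "Suppose that ACIT over `ℤ` is in NSUBEXP.
If Perm over `ℤ` is computable by polynomial-size arithmetic circuits (over `ℤ`, without
divisions), then Perm ∈ NSUBEXP" — i.e. the graph language `permanent01Graph` is in
`⋂_{ε>0} NTIME(2^{n^ε})` (p. 357). Printed proof: guess a polynomial-size circuit for Perm on
`n × n` matrices, verify it through the downward self-reduction identities (1)–(2) of Lemma 11 —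
polynomial identity tests for division-free circuits, decided by the assumed NSUBEXP algorithm —
then evaluate it on the given `0/1` matrix modulo `2^{n log n + 1}`. Vendored in the special case
consumed by pnp.S39: ACIT is the tree's `PITLanguage` (division-free integer circuits
`ArithCircuit ℤ (Fin n)`), NSUBEXP is `⋂_{r>0} NTIME(2^{⌊n^{1/r}⌋})`, and "polynomial-size
circuits" is specialised to p-bounded *constant-free* complexity of `(PER_n)`
(`constantFreeComplexity`; constants `0, ±1` have bit size one, so this is a sub-case of KI's size
measure of §2.2). Named fact. [cite: KabanetsImpagliazzo2003, Cor. 12 (p. 358)] -/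
def permanent01Graph_mem_NSUBEXP_of_PIT : Prop :=
  PITLanguage ∈ NSUBEXP →
    IsPBounded (fun n => constantFreeComplexity (perPoly (Fin n) ℤ)) →
      permanent01Graph ∈ NSUBEXP

/-- **Kabanets–Impagliazzo 2003, Lemma 3** (p. 357): "If Perm ∈ NTIME(t), then
`P^{Perm} ⊆ NTIME(poly(n) t(poly(n)))`" (guess the value of every oracle query together with its
NTIME(t)-certificate; note "if Perm ∈ NTIME(t) then Perm ∈ coNTIME(t)", p. 357), in the instance
of the proof of Thm. 18 (p. 359: "by Theorem 16, Perm ∈ NTIME(2^{n^ε}) for every ε > 0. Hence,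
we obtain by Lemma 3 that coNEXP ⊆ NTIME(2^{n^ε})"), i.e. with `t` ranging over all
`2^{n^ε}`: `Perm ∈ NSUBEXP ⟹ P^{Perm} ⊆ NSUBEXP`. Here `P^{Perm}` is `PRel (Oracle.ofFun per01Fn)`
(polynomial-time Turing reductions to the `0/1` permanent answered in binary, transcript model of
`Oracle.lean`; malformed queries are answered `0`, a polynomial-time detectable convention), and
`NSUBEXP = ⋂_{r>0} NTIME(2^{⌊n^{1/r}⌋})`. Named fact. [cite: KabanetsImpagliazzo2003, Lemma 3 (p. 357) and proof of Thm. 18 (p. 359)] -/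
def PRel_per01_subset_NSUBEXP_of_graph : Prop :=
  permanent01Graph ∈ NSUBEXP → PRel (Oracle.ofFun per01Fn) ⊆ NSUBEXP

/-- **Cor. 12 with Lemma 3** (proved from the two facts): if `PIT ∈ NSUBEXP` and `(PER_n)` has
p-bounded constant-free circuits, then `P^{per} ⊆ NSUBEXP` — the combination used in the proof of
KI Thm. 18 (p. 359); Arora–Barak's Lemma 20.19 is its `PIT ∈ P` / `NP` analogue.
[cite: KabanetsImpagliazzo2003, proof of Thm. 18 (p. 359)] -/
theorem PRel_per01_subset_NSUBEXP_of_PIT (h12 : permanent01Graph_mem_NSUBEXP_of_PIT)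
    (h3 : PRel_per01_subset_NSUBEXP_of_graph) (hPIT : PITLanguage ∈ NSUBEXP)
    (hper : IsPBounded (fun n => constantFreeComplexity (perPoly (Fin n) ℤ))) :
    PRel (Oracle.ofFun per01Fn) ⊆ NSUBEXP :=
  h3 (h12 hPIT hper)

/-! ### `P^{PP} ⊆ P^{per}` (proved) -/

/-- **`P^{PP} ⊆ P^{per}`**: `L ≤ᵀₚ A` with `A ∈ PP ⊆ P^{#P} ⊆ P^{per}` gives `L ∈ P^{per}` by
`P^{P^{O}} = P^{O}` (`mem_PRel_of_polyTimeTuringReducible_holds`); `P^{#P} ⊆ P^{per}` is the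
tree's `PSharpP_subset_PRel_per01Fn` (Valiant's theorem composed with
`OracleAlg.PRel_subset_PRel_of_mem_FPRel`). Uses the named fact `PP_subset_PSharpP` and Valiant's
theorem (KI 2003, Thms. 1–2; Arora–Barak 2009, proof of Thm. 20.17: "`PH ⊆ P^{#P}` ... perm is
`#P`-complete. Thus ... `NEXP ⊆ P^{perm}`"). [cite: AroraBarakCC2009, proof of Thm. 20.17 (p. 418)] -/
theorem PRelClass_PP_subset_PRel_per01 (hPP : PP_subset_PSharpP)
    (hV : permanent01_isSharpPHardFun) : PRelClass PP ⊆ PRel (Oracle.ofFun per01Fn) := by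
  intro L hL
  obtain ⟨A, hA, hLA⟩ := mem_PRelClass_iff.1 hL
  exact mem_PRel_of_polyTimeTuringReducible_holds hLA (PSharpP_subset_PRel_per01Fn hV (hPP hA))

/-- **KI Cor. 5 / AB (20.17): `NEXP ⊆ P/poly ⟹ NEXP ⊆ P^{per}`** — `NEXP = EXP = Σ₂ᵖ ⊆ PH`
(IKW, Meyer) `⊆ P^{PP}` (Toda) `⊆ P^{per}` (Valiant). [cite: KabanetsImpagliazzo2003, Cor. 5 (p. 357)] [cite: AroraBarakCC2009, proof of Thm. 20.17, (20.17) (p. 418)] -/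
theorem NEXP_subset_PRel_per01_of_subset_PPoly (hI : NEXP_eq_EXP_of_subset_PPoly)
    (hM : EXP_eq_SigmaP_two_of_subset_PPoly) (hToda : toda_PH_subset_PRelClass_PP)
    (hPP : PP_subset_PSharpP) (hV : permanent01_isSharpPHardFun) (h : NEXP ⊆ PPoly) :
    NEXP ⊆ PRel (Oracle.ofFun per01Fn) :=
  (NEXP_subset_PH_of_subset_PPoly hI hM h).trans
    (hToda.trans (PRelClass_PP_subset_PRel_per01 hPP hV))

/-! ### Assembly -/

/-- **pnp.S39 from the named facts.** Kabanets–Impagliazzo 2003, proof of Thm. 18 (p. 359) along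
Arora–Barak's `EXP`-route (proof of Thm. 20.17, p. 418): assume `PIT ∈ NSUBEXP`, `NEXP ⊆ P/poly`
and p-bounded constant-free circuits for `(PER_n)`; then `NEXP ⊆ P^{per}` (IKW, Meyer, Toda,
Valiant) and `P^{per} ⊆ NSUBEXP` (Cor. 12 + Lemma 3), so `NEXP ⊆ NSUBEXP ⊆ NTIME(2ⁿ)`,
contradicting the nondeterministic time hierarchy (`NTIME(2^{n²}) ⊆ NEXP`, but
`NTIME(2^{n²}) ⊄ NTIME(2ⁿ)`). When all hypotheses are discharged this is
`kabanets_impagliazzo_holds`.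
[cite: KabanetsImpagliazzo2003, Thm. 18 (p. 359)] [cite: AroraBarakCC2009, Thm. 20.17 (pp. 415–418)] -/
theorem kabanets_impagliazzo_of_facts (hI : NEXP_eq_EXP_of_subset_PPoly)
    (hM : EXP_eq_SigmaP_two_of_subset_PPoly) (hToda : toda_PH_subset_PRelClass_PP)
    (hPP : PP_subset_PSharpP) (hV : permanent01_isSharpPHardFun)
    (h12 : permanent01Graph_mem_NSUBEXP_of_PIT) (h3 : PRel_per01_subset_NSUBEXP_of_graph)
    (hH : ntime_hierarchy) : kabanets_impagliazzo := by
  intro hPIT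
  by_contra hcon
  rw [not_or, not_not, not_not] at hcon
  obtain ⟨hNEXP, hper⟩ := hcon
  have hPIT' : PITLanguage ∈ NSUBEXP := mem_NSUBEXP_iff.2 hPIT
  exact NEXP_not_subset_NSUBEXP_of hH
    ((NEXP_subset_PRel_per01_of_subset_PPoly hI hM hToda hPP hV hNEXP).trans
      (PRel_per01_subset_NSUBEXP_of_PIT h12 h3 hPIT' hper))

/-- The same assembly with the conclusion unfolded: under the facts, the three hypotheses
`PIT ∈ NSUBEXP`, `NEXP ⊆ P/poly`, "`(PER_n)` has p-bounded constant-free circuits" are jointly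
contradictory (AB: "the three statements (20.14), (20.15), (20.16) cannot be simultaneously
true"). [cite: AroraBarakCC2009, proof of Thm. 20.17 (p. 418)] -/
theorem false_of_PIT_NEXP_per (hI : NEXP_eq_EXP_of_subset_PPoly)
    (hM : EXP_eq_SigmaP_two_of_subset_PPoly) (hToda : toda_PH_subset_PRelClass_PP)
    (hPP : PP_subset_PSharpP) (hV : permanent01_isSharpPHardFun)
    (h12 : permanent01Graph_mem_NSUBEXP_of_PIT) (h3 : PRel_per01_subset_NSUBEXP_of_graph)
    (hH : ntime_hierarchy) (hPIT : PITLanguage ∈ NSUBEXP) (hNEXP : NEXP ⊆ PPoly)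
    (hper : IsPBounded (fun n => constantFreeComplexity (perPoly (Fin n) ℤ))) : False :=
  NEXP_not_subset_NSUBEXP_of hH
    ((NEXP_subset_PRel_per01_of_subset_PPoly hI hM hToda hPP hV hNEXP).trans
      (PRel_per01_subset_NSUBEXP_of_PIT h12 h3 hPIT hper))

end Literature.Computability.AlgebraicComplexity

end
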